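import Mathlib
import Summits.KontsevichZagierPeriods.Zeta5Search.RecordWindowsA4
import HarnessLib

/-!
# ζ(5) search — FOURTH order: the classwise fourth digit (with its harmonic correction `λ_p = H⁽²⁾_{p−1}/(2p)`), the SECOND
RESIDUE LAW (THEOREM L5: `casLB + 5` below the edge `p(M−4) ≤ 2d+1`) and the record windows `−104 / −96 / −88`, statement layer (gen-2 g13)

Cell `pub-zeta5` (HONEST FRAMING: systematic search; no irrationality claim unless certified), ideation seat gen-2, generation 13
(`HOME/pub-zeta5-gen-2/REPORT-gen2-g13.md`).  INCREMENT over the tree's `Zeta5Search/ThirdOrderDigit.lean` (g10: `phi2Hat`, `curvHat`, `wHat3`,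
`vHat3`, `ThirdDigitW/V`, `isRaise2`, `LawA4`) and `Zeta5Search/RecordWindowsA4.lean` (g12: `T56/T52/T48`, `LawA4Classes`, `RecClassesM..`,
`RecWindowM..` = `7 − 2M`).  New namespace, nothing redeclared; STATEMENTS (`@[conjecture] def … : Prop`) plus PROVED reductions.
Nothing here bears on irrationality: these are `p`-adic digits of the partial-fraction data of the Brown–Zudilin rational function `R_b` and the
resulting valuation of the contiguity Casoratian `Cas_j(b) = W(b+e_j)V(b) − W(b)V(b+e_j)`; the record-ray statements are CENSUS WHAT-IF rungs
(they raise the certified decay exponent only once proved for all `n`).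

## §1 The classwise FOURTH digit (REPORT §2; `W`-row PROVED on paper as (W3) one order further; `V`-row exact-checked, proof sketched)
With `Ĝ_x(η) ≡ 1 − pφη + p²cη² − p³c₃η³ (mod p⁴)`, `c₃ := φ³/6 − φφ₂/2 + φ₃/3` (`φ₃ = phi3Hat`), and the functionals of `η³Φ_x`
(`ŵ₄ = wHat4`, `v̂₄ = vHat4`):  `W_x ≡ (−p)^{E+3} ĝ (ŵ − pφŵ₂ + p²cŵ₃ − p³c₃ŵ₄) (mod p^{E+7})` and, for `E ≤ −4`,
`V_x ≡ (−p)^E ĝ (v̂ − pφv̂₂ + p²cv̂₃ − p³c₃v̂₄ − (p²/2)·H⁽²⁾_{p−1}·ŵ) (mod p^{E+4})`.  The LAST TERM is new at this order: the harmonic residues of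
the level sums no longer cancel (as they did at order three, g10 §6) but leave the universal multiple `λ_p ŵ_x`, `λ_p := H⁽²⁾_{p−1}/(2p) ∈ ℤ_(p)`
(Wolstenholme: `p ∣ H⁽²⁾_{p−1}`), of the LEADING `W`-digit.  Exact check (`g13/fourthdigit.py`, seeds 1,5,6,7): every pole class satisfies (W4)/(U4);
every class with `E ≤ −4` satisfies (V4) WITH the correction (47,120 classes with `E ≤ −4`, 0 failures) and about one third of them violate it without (defect exactly one digit, `≡ λ_p ŵ_x`).
In the orbit sums of a `LawA4` frame the correction is `p²λ_p Σ_{E_x=−M} ĝ_xŵ_x ≡ 0 (mod p³)` by the first-digit pair cancellation, so it never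
reaches the Casoratian digit below — but it is part of the true classwise statement.

## §2 T-shapes and THEOREM L5 (REPORT §1, §3; PROVED on paper from (W1–W4), (V1–V4), the pair symmetry and the residue theorem on `P¹(F_p)`)
In a frame `(M,T)` of `LawA4` write `r(b) := p⁻¹ Σ_x (W_x/(−p)^{3−M}, V_x/(−p)^{−M}) = ατ + Bτ₃` in the basis `τ = σ_T[2η−L]`, `τ₃ = σ_T[(2η−L)³]`
(`σ_T[F] := (ŵ[FΦ_T], v̂[FΦ_T])`; the even moments of the palindrome vanish).  THEOREM A⁗ is `v_p(B) ≥ 2`.  If in addition every pole class of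
exponent `−M+3` is a T-SHAPE OF DEGREE 3 (`isRaiseN 3 T`: three single raises — the classes of exponent `−M+i`, `i ≤ 2`, are T-shapes of degree
`i` by the `LawA4` clauses) and `M ≥ 10`, then every class `x` of exponent `−M+i`, `i ≤ 3`, contributes `−p²ĝ_xκ_i(x)/8` to `B (mod p³)` with
`κ₃ = 1, κ₂ = φ_x, κ₁ = c_x, κ₀ = c₃,x`, i.e. `ĝ_xκ_i(x) ≡ [ε^{3−i}] G_x(−x+ε) = Res_{t=−x} R̄_b(t)(t+x)^{M−4} dt = Res_{t=−x} R̄_b D^{M−4} dt` over `F_p`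
(`D = t^p − t = (t+x)^p − (t+x)`; classes with `i ≥ 4` have zero residue), hence
`B/p² ≡ −(1/8) Σ_{x ∈ F_p} Res_{−x}(R̄_b D^{M−4} dt) = (1/8) Res_∞ = (1/8)[u^K] (2∏_x(1+xu)^{E_x}(1−u^{p−1})^{M−4})`, `K = Σ_xE_x + p(M−4) + 1 = p(M−4) − 2d − 4`
(`Σ_x E_x = −2d − 5`, `d = dOf b`).  SECOND RESIDUE LAW: `K < 0 ⇒ B ≡ 0 (mod p³)`.  The hit `e_j` lowers `d` by one, so
**THEOREM L5**: frame clauses + degree-3 T-shapes for `b` and `b+e_j`, `M ≥ 10`, and `p(M−4) ≤ 2d(b) + 1` (`⟺ K(b+e_j) < 0`) `⇒ v_p(Cas_j(b)) ≥ 8 − 2M = casLB + 5`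
(`casLB + 3` in the shifted frames `M = 1 − m` of g12).  Exact census (`g13/reslaw2.py`, seeds 1–3, `b₀ ≤ 90`, `M ≥ 10`): the digit `B/p² (mod p)`
equals the residue prediction in every instance of the hypotheses (direct and shifted frames, for `b` and `b+e_j`), and hypotheses ⇒ excess `≥ 5`
in every instance; with `K(b+e_j) ≥ 0` the excess is `4` in most instances (the law is sharp).  On the record ray the edge `p(M−4) = 50n`
is `θ = 25/26` (frame 56), `25/24` (frame 52) — exactly the steps of the Brown–Zudilin exponent `e_G` left unexplained by A⁗ — and `25/22 > 9/8` (frame 48).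

## §3 Record windows (REPORT §4): A⁗ + L5 = the Brown–Zudilin valuation on all 40 `LawA4` windows of g12
`p`-adic exact values (g12 `vpadic.py`, ≥ 56 certified digits; three of them PREDICTED by L5 before the computation, marked *):
(45,43) −104, (62,59) −104, (40,41) −96, (46,47)* −96, (51,53)* −96, (53,59) −88, (42,47) −88, (60,67)* −88; and `= 7 − 2M` exactly where
`K(b+e₇) ≥ 0` ((44,43) −105, (56,59) −97) or the degree-3 shape clause fails ((64,71) −89: the classes of exponent −45 have lists `…,−4,−6,…`
skipping `−5`; so at all 22 window primes of `(11/10, 10/9]` with `n ≤ 150`).  The shape hypotheses `RecShapesM..` are verified at every window prime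
with `n ≤ 150` (35 + 78 + 31 instances, `b` and `b+e₇`).
-/

open Finset

namespace Summit.KontsevichZagierPeriods.Zeta5Search.SecondResidueLaw

open Summit.KontsevichZagierPeriods.Zeta5Search.ClusterValuation
open Summit.KontsevichZagierPeriods.Zeta5Search.WedgeDictionary (pfData dOf)
open Summit.KontsevichZagierPeriods.Zeta5Search.CasoratianValuation (InPolytope shift casoratian)
open Summit.KontsevichZagierPeriods.Zeta5Search.SecondOrder (phiHat phi2Hat curvHat wHat2 vHat2 wHat3 vHat3 classTypeList isRaise isRaise2
  raiseAtList LawA4)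
open Summit.KontsevichZagierPeriods.Zeta5Search.RecordWindowsA4 (T56 T52 T48 T56_reverse T52_reverse T48_reverse LawA4Classes
  RecClassesM56 RecClassesM52 RecClassesM48)
open Literature.NumberTheory.Transcendental.BallRivoal (harm)

/-! ## §1 Fourth-order class invariants and the classwise fourth digit -/

/-- `φ₃,x := Σ_{s ∉ class(x)} netExp(s)/(s − x)³` (+ the odd centre outside the class). -/
def phi3Hat (b : ℕ → ℤ) (p x : ℕ) : ℚ :=
  (∑ s ∈ (range ((b 0).toNat + 1)).filter (fun s => s % p ≠ x % p), (netExp b s : ℚ) / ((s : ℚ) - x) ^ 3)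
    + (if ¬ (2 : ℤ) ∣ b 0 ∧ ¬ CentreIn b p x then 1 / ((b 0 : ℚ) / 2 - x) ^ 3 else 0)

/-- `c₃,x := φ_x³/6 − φ_xφ₂,x/2 + φ₃,x/3`: the cubic Taylor coefficient of the foreign factor,
`ĝ_{x+ℓp} ≡ ĝ_x (1 − ℓpφ_x + ℓ²p²c_x − ℓ³p³c₃,x) (mod p⁴)`. -/
def cubicHat (b : ℕ → ℤ) (p x : ℕ) : ℚ :=
  phiHat b p x ^ 3 / 6 - phiHat b p x * phi2Hat b p x / 2 + phi3Hat b p x / 3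

/-- `ŵ₄_x := ŵ[η³Φ_x] = Σ_{poles q} (ℓ_q³ ρ_{q,3} + 3ℓ_q² ρ_{q,4} + 3ℓ_q ρ_{q,5} + ρ_{q,6})`. -/
noncomputable def wHat4 (b : ℕ → ℤ) (p x : ℕ) : ℚ :=
  ∑ q ∈ classPoles b p x,
    ((if netExp b q ≤ -3 then ((q / p : ℕ) : ℚ) ^ 3 * classRho b p q 3 else 0)
      + (if netExp b q ≤ -4 then 3 * ((q / p : ℕ) : ℚ) ^ 2 * classRho b p q 4 else 0)
      + (if netExp b q ≤ -5 then 3 * ((q / p : ℕ) : ℚ) * classRho b p q 5 else 0)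
      + (if netExp b q ≤ -6 then classRho b p q 6 else 0))

/-- `v̂₄_x := v̂[η³Φ_x] = Σ_{poles q} Σ_{σ=1}^{n_q} (−1)^σ (ℓ_q³ ρ_{q,σ} + 3ℓ_q² ρ_{q,σ+1} + 3ℓ_q ρ_{q,σ+2} + ρ_{q,σ+3}) H^{(σ)}_{ℓ_q}`. -/
noncomputable def vHat4 (b : ℕ → ℤ) (p x : ℕ) : ℚ :=
  ∑ q ∈ classPoles b p x, ∑ σ ∈ Icc 1 (-netExp b q).toNat,
    (-1 : ℚ) ^ σ * (((q / p : ℕ) : ℚ) ^ 3 * classRho b p q σ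
        + (if (σ : ℤ) + 1 ≤ -netExp b q then 3 * ((q / p : ℕ) : ℚ) ^ 2 * classRho b p q (σ + 1) else 0)
        + (if (σ : ℤ) + 2 ≤ -netExp b q then 3 * ((q / p : ℕ) : ℚ) * classRho b p q (σ + 2) else 0)
        + (if (σ : ℤ) + 3 ≤ -netExp b q then classRho b p q (σ + 3) else 0)) * harm σ (q / p)

/-- `λ_p := H⁽²⁾_{p−1}/(2p)` — a `p`-adic integer for `p ≥ 5` (Wolstenholme `p ∣ H⁽²⁾_{p−1}`); the universal coefficient of the harmonic
correction in the fourth `V`-digit.  Values `λ_p mod p` for `p = 5, 7, 11, 13, 17, 19, 23`: `2, 1, 5, 6, 7, 5, 5`. -/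
def lambdaP (p : ℕ) : ℚ := harm 2 (p - 1) / (2 * p)

/-- The fourth-order `W`-prediction `(−p)^{E+3} ĝ_x (ŵ − pφŵ₂ + p²cŵ₃ − p³c₃ŵ₄)`. -/
noncomputable def predW4 (b : ℕ → ℤ) (p x : ℕ) : ℚ :=
  (-(p : ℚ)) ^ (classExp b p x + 3) * gHat b p x
    * (wHat b p x - (p : ℚ) * phiHat b p x * wHat2 b p x + (p : ℚ) ^ 2 * curvHat b p x * wHat3 b p x
        - (p : ℚ) ^ 3 * cubicHat b p x * wHat4 b p x)

/-- The fourth-order `V`-prediction `(−p)^E ĝ_x (v̂ − pφv̂₂ + p²cv̂₃ − p³c₃v̂₄ − (p²/2) H⁽²⁾_{p−1} ŵ)` (last term `= −p³λ_p ŵ`). -/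
noncomputable def predV4 (b : ℕ → ℤ) (p x : ℕ) : ℚ :=
  (-(p : ℚ)) ^ (classExp b p x) * gHat b p x
    * (vHat b p x - (p : ℚ) * phiHat b p x * vHat2 b p x + (p : ℚ) ^ 2 * curvHat b p x * vHat3 b p x
        - (p : ℚ) ^ 3 * cubicHat b p x * vHat4 b p x - (p : ℚ) ^ 3 * lambdaP p * wHat b p x)

/-- **(W4) fourth digit of the `W`-row:** `W_x ≡ (−p)^{E+3} ĝ_x (ŵ − pφŵ₂ + p²cŵ₃ − p³c₃ŵ₄)  (mod p^{E+7})` (REPORT §2; PROVED on paper as (W3);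
exact check `g13/fourthdigit.py`: every pole class, 0 failures). -/
@[conjecture] def FourthDigitW : Prop :=
  ∀ (b : ℕ → ℤ) (p x : ℕ), InPolytope b → p.Prime → 5 ≤ p → (b 0 + 2 : ℤ) < (p : ℤ) ^ 2 → x < p → 1 ≤ classPoleCount b p x →
    (∑ s ∈ classSet b p x, pfData b 2 s) - predW4 b p x ≠ 0 →
      classExp b p x + 7 ≤ padicValRat p ((∑ s ∈ classSet b p x, pfData b 2 s) - predW4 b p x)

/-- **(V4) fourth digit of `V_x` (`E_x ≤ −4`), WITH the harmonic correction `−p³λ_pŵ_x`:**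
`V_x ≡ (−p)^E ĝ_x (v̂ − pφv̂₂ + p²cv̂₃ − p³c₃v̂₄ − p³λ_pŵ)  (mod p^{E+4})` (REPORT §2; exact check `g13/fourthdigit.py`: every class with `E ≤ −4`,
0 failures; without the `λ_p` term about one third of the classes fail by exactly one digit). -/
@[conjecture] def FourthDigitV : Prop :=
  ∀ (b : ℕ → ℤ) (p x : ℕ), InPolytope b → p.Prime → 5 ≤ p → (b 0 + 2 : ℤ) < (p : ℤ) ^ 2 → x < p → 1 ≤ classPoleCount b p x →
    classExp b p x ≤ -4 → classV b p x - predV4 b p x ≠ 0 →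
      classExp b p x + 4 ≤ padicValRat p (classV b p x - predV4 b p x)

/-! ## §2 T-shapes of degree `k` and THEOREM L5 -/

/-- `isRaiseN k T S`: `S` is a T-SHAPE OF DEGREE `k` — obtained from `T` by exactly `k` SINGLE RAISES (one entry increased by `1`, or one new
end entry `1`; `Φ_S = P·Φ_T` with `P` a monic polynomial of degree `k` whose roots are levels of, or adjacent to, the support).
`isRaiseN 1 = isRaise`, and `isRaise2 T S → isRaiseN 2 T S`. -/
def isRaiseN : ℕ → List ℤ → List ℤ → Bool
  | 0, T, S => S == T
  | k + 1, T, S => (((List.range T.length).map fun i => raiseAtList T i) ++ [1 :: T, T ++ [1]]).any fun U => isRaiseN k U S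

/-- Sanity: `[2, -5] ` is a degree-3 T-shape of `[-6]` (new end level raised twice, the pole raised once) … -/
example : isRaiseN 3 [-6] [2, -5] = true := by decide
/-- … and `[1, 0, -6]` (a gap) is not a degree-1 T-shape of `[-6]`. -/
example : isRaiseN 1 [-6] [1, 0, -6] = false := by decide

/-- **Shape clause (T4)** of the frame `(M,T)`: every pole class with `ν = −M+3` has a type list that is a degree-3 T-shape of `T`, or is the
odd-centre class (for `b₀` odd the half-integer centre adds `1` to the exponent but is not a list entry) with a degree-2 T-shape. -/
def ShapeClause (b : ℕ → ℤ) (p M : ℕ) (T : List ℤ) : Prop :=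
  ∀ z, z < p → 1 ≤ classPoleCount b p z → classNu b p z = -(M : ℤ) + 3 →
    isRaiseN 3 T (classTypeList b p z) = true ∨ (¬ (2 : ℤ) ∣ b 0 ∧ CentreIn b p z ∧ isRaiseN 2 T (classTypeList b p z) = true)

/-- **THEOREM L5 (second residue law; casLB + 5).**  Frame `(M, T)` as in `LawA4` (`M` even, `T` a palindrome) with `M ≥ 10`, the `LawA4` class
clauses AND the shape clause (T4) for both `b` and `b + e_j`, and the degree condition `p(M−4) ≤ 2d(b) + 1` (i.e. `K(b+e_j) < 0`).  Then
`v_p(Cas_j(b)) ≥ 8 − 2M`.  (PROVED on paper, REPORT-gen2-g13 §3, from (W1)–(W4), (V1)–(V4), the pair symmetry and the residue theorem;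
exact census `g13/reslaw2.py`: 0 exceptions.) -/
@[conjecture] def LawA5 : Prop :=
  ∀ (b : ℕ → ℤ) (p j M : ℕ) (T : List ℤ), InPolytope b → InPolytope (shift b j) → 1 ≤ j → j ≤ 7 → p.Prime → 5 ≤ p → (p : ℤ) ≤ b 0 →
    (b 0 + 2 : ℤ) < (p : ℤ) ^ 2 → 10 ≤ M → Even M → T.reverse = T →
    LawA4Classes b p M T → LawA4Classes (shift b j) p M T → ShapeClause b p M T → ShapeClause (shift b j) p M T →
    (p : ℤ) * ((M : ℤ) - 4) ≤ 2 * dOf b + 1 →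
    casoratian b j ≠ 0 → (8 : ℤ) - 2 * M ≤ padicValRat p (casoratian b j)

/-- **Sharpness of the edge (negative side, exact data):** with all hypotheses of `LawA5` except the degree condition, the bound `8 − 2M` FAILS in
general — e.g. the record instance `(n,p) = (44,43)` (frame 56, `43·52 = 2236 > 2201 = 50·44+1`): `v₄₃(Cas₇(b(44))) = −105 = 7 − 2M` exactly
(g12 `vpadic.py`, 57 certified digits).  Recorded as the statement that the valuation there is exactly `−105`. -/
@[conjecture] def EdgeSharpM56 : Prop :=
  padicValRat 43 (casoratian (bRec 44) 7) = -105

/-! ## §3 The record ray near `θ = 1`: shape clauses and the L5 windows `−104 / −96 / −88` (census what-if rungs, REPORT §4) -/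

/-- The four class-structure clauses L5 needs at a record instance: `LawA4` clauses and (T4) for `b(n)` and for `b(n) + e₇`. -/
def RecFrameL5 (n p M : ℕ) (T : List ℤ) : Prop :=
  LawA4Classes (bRec n) p M T ∧ LawA4Classes (shift (bRec n) 7) p M T ∧ ShapeClause (bRec n) p M T ∧ ShapeClause (shift (bRec n) 7) p M T

/-- **CLASS STRUCTURE for L5, frame 56** on `17n < 18p`, `26p ≤ 25n` (`θ ∈ (17/18, 25/26]`): verified at every window prime with `40 ≤ n ≤ 150`
(`g13/rayshape_M56.txt`; direct frame on `43p ≥ 41n+3`, shifted frame below). -/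
@[conjecture] def RecShapesM56 : Prop :=
  ∀ n p : ℕ, 2 ≤ n → p.Prime → 17 * n < 18 * p → 26 * p ≤ 25 * n → 41 * n + 2 < p ^ 2 → RecFrameL5 n p 56 T56

/-- **CLASS STRUCTURE for L5, frame 52** on `n < p`, `24p ≤ 25n` (`θ ∈ (1, 25/24]`): verified at every window prime with `40 ≤ n ≤ 150`
(`g13/rayshape_M52.txt`). -/
@[conjecture] def RecShapesM52 : Prop :=
  ∀ n p : ℕ, 2 ≤ n → p.Prime → n < p → 24 * p ≤ 25 * n → 41 * n + 2 < p ^ 2 → RecFrameL5 n p 52 T52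

/-- **CLASS STRUCTURE for L5, frame 48** on `10n < 9p`, `8p ≤ 9n` (`θ ∈ (10/9, 9/8]`): verified at every window prime with `33 ≤ n ≤ 150`
(`g13/rayshape_M48.txt`).  (On `(11/10, 10/9]` the shape clause FAILS — classes of exponent `−45` skip the stair `−5` — and the valuation is `7 − 2M = −89`
exactly, e.g. `(64,71)`: L5 is sharp there too.) -/
@[conjecture] def RecShapesM48 : Prop :=
  ∀ n p : ℕ, 2 ≤ n → p.Prime → 10 * n < 9 * p → 8 * p ≤ 9 * n → 41 * n + 2 < p ^ 2 → RecFrameL5 n p 48 T48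

/-- **RECORD WINDOW L5, frame 56** (`θ ∈ (17/18, 25/26]`): `v_p(Cas₇(b(n))) ≥ −104` (= the Brown–Zudilin value: exact at (45,43), (62,59), (64,61);
census proved column `−107 / −106`, A⁗ `−105`). -/
@[conjecture] def RecWindowL5M56 : Prop :=
  ∀ n p : ℕ, 2 ≤ n → p.Prime → 17 * n < 18 * p → 26 * p ≤ 25 * n → 41 * n + 2 < p ^ 2 →
    casoratian (bRec n) 7 ≠ 0 → (-104 : ℤ) ≤ padicValRat p (casoratian (bRec n) 7)

/-- **RECORD WINDOW L5, frame 52** (`θ ∈ (1, 25/24]`): `v_p(Cas₇(b(n))) ≥ −96` (= the Brown–Zudilin value: exact at (40,41), (46,47), (51,53);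
census proved column `−99 / −98`, A⁗ `−97`). -/
@[conjecture] def RecWindowL5M52 : Prop :=
  ∀ n p : ℕ, 2 ≤ n → p.Prime → n < p → 24 * p ≤ 25 * n → 41 * n + 2 < p ^ 2 →
    casoratian (bRec n) 7 ≠ 0 → (-96 : ℤ) ≤ padicValRat p (casoratian (bRec n) 7)

/-- **RECORD WINDOW L5, frame 48** (`θ ∈ (10/9, 9/8]`): `v_p(Cas₇(b(n))) ≥ −88` (= the Brown–Zudilin value: exact at (42,47), (53,59), (60,67);
census proved column `−91 / −90`, A⁗ `−89`). -/
@[conjecture] def RecWindowL5M48 : Prop :=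
  ∀ n p : ℕ, 2 ≤ n → p.Prime → 10 * n < 9 * p → 8 * p ≤ 9 * n → 41 * n + 2 < p ^ 2 →
    casoratian (bRec n) 7 ≠ 0 → (-88 : ℤ) ≤ padicValRat p (casoratian (bRec n) 7)

/-! ## §4 The reductions (PROVED): `LawA5` + class structure ⇒ window bound -/

/-- A window prime with `p² > 41n+2`, `n ≥ 2` is at least `5`. -/
private theorem five_le_of_sq (n p : ℕ) (hn : 2 ≤ n) (h : 41 * n + 2 < p ^ 2) : 5 ≤ p := by
  by_contra hc
  have hp4 : p ≤ 4 := by omega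
  have : p ^ 2 ≤ 4 ^ 2 := Nat.pow_le_pow_left hp4 2
  omega

/-- `b₀` of the record ray is `41n`. -/
private theorem bRec_zero' (n : ℕ) : bRec n 0 = 41 * (n : ℤ) := by
  simp [bRec]; ring

/-- `d(b(n)) = 3·41n − 98n = 25n` on the record ray. -/
private theorem dOf_bRec (n : ℕ) : dOf (bRec n) = 25 * (n : ℤ) := by
  simp [dOf, bRec, Finset.sum_range_succ]; ring

/-- `LawA5` applied at a record instance (bookkeeping): frame `(M,T)`, direction `7`, the degree condition as `p(M−4) ≤ 50n+1`. -/
theorem lawA5_bRec (hA : LawA5) (n p M : ℕ) (T : List ℤ) (hn : 2 ≤ n) (hp : p.Prime) (hpn : p ≤ 41 * n)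
    (hsq : 41 * n + 2 < p ^ 2) (hM : 10 ≤ M) (hE : Even M) (hT : T.reverse = T) (hF : RecFrameL5 n p M T)
    (hdeg : (p : ℤ) * ((M : ℤ) - 4) ≤ 50 * (n : ℤ) + 1) (hne : casoratian (bRec n) 7 ≠ 0) :
    (8 : ℤ) - 2 * M ≤ padicValRat p (casoratian (bRec n) 7) := by
  obtain ⟨c1, c2, c3, c4⟩ := hF
  have h5 : 5 ≤ p := five_le_of_sq n p hn hsq
  have hpb : (p : ℤ) ≤ bRec n 0 := by rw [bRec_zero']; exact_mod_cast hpn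
  have hp2 : (bRec n 0 + 2 : ℤ) < (p : ℤ) ^ 2 := by rw [bRec_zero']; exact_mod_cast hsq
  have hd : (p : ℤ) * ((M : ℤ) - 4) ≤ 2 * dOf (bRec n) + 1 := by rw [dOf_bRec]; linarith
  exact hA (bRec n) p 7 M T (inPolytope_bRec n) (inPolytope_shift_bRec n 7 (by omega) (by norm_num) (by norm_num))
    (by norm_num) (by norm_num) hp h5 hpb hp2 hM hE hT c1 c2 c3 c4 hd hne

/-- **Reduction (PROVED)**: `LawA5` and `RecShapesM56` give `RecWindowL5M56` (`−104`). -/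
theorem recWindowL5M56_of (hA : LawA5) (hS : RecShapesM56) : RecWindowL5M56 := by
  intro n p hn hp h1 h2 h3 hne
  have key := lawA5_bRec hA n p 56 T56 hn hp (by omega) h3 (by norm_num) (by decide) T56_reverse (hS n p hn hp h1 h2 h3)
    (by push_cast; nlinarith [h2]) hne
  have e : (8 : ℤ) - 2 * ((56 : ℕ) : ℤ) = -104 := by norm_num
  rw [e] at key; exact key

/-- **Reduction (PROVED)**: `LawA5` and `RecShapesM52` give `RecWindowL5M52` (`−96`). -/
theorem recWindowL5M52_of (hA : LawA5) (hS : RecShapesM52) : RecWindowL5M52 := by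
  intro n p hn hp h1 h2 h3 hne
  have key := lawA5_bRec hA n p 52 T52 hn hp (by omega) h3 (by norm_num) (by decide) T52_reverse (hS n p hn hp h1 h2 h3)
    (by push_cast; nlinarith [h2]) hne
  have e : (8 : ℤ) - 2 * ((52 : ℕ) : ℤ) = -96 := by norm_num
  rw [e] at key; exact key

/-- **Reduction (PROVED)**: `LawA5` and `RecShapesM48` give `RecWindowL5M48` (`−88`). -/
theorem recWindowL5M48_of (hA : LawA5) (hS : RecShapesM48) : RecWindowL5M48 := by
  intro n p hn hp h1 h2 h3 hne
  have key := lawA5_bRec hA n p 48 T48 hn hp (by omega) h3 (by norm_num) (by decide) T48_reverse (hS n p hn hp h1 h2 h3)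
    (by push_cast; nlinarith [h2]) hne
  have e : (8 : ℤ) - 2 * ((48 : ℕ) : ℤ) = -88 := by norm_num
  rw [e] at key; exact key

end Summit.KontsevichZagierPeriods.Zeta5Search.SecondResidueLaw
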